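import Literature.NumberTheory.LFunctions.SuzukiSingleOperatorKernelProofs
import Literature.NumberTheory.LFunctions.ZetaLogDerivStripBound
import HarnessLib

/-!
# Suzuki's single-operator kernel: the sharp growth `K_θ(x) ≪ e^{x/2}` of [Su20] Thm. 1.2 (K-ii)

LINE 1 — LABEL: RH-FREE (an unconditional growth bound for the spectrally defined kernel `K_θ`;
bears_on: B-C/B-P (LADDER-RH COLUMN 6 DBR, [Su20] Thm. 1.2). FRAMING (cell rh-crit, D-0074): corpus
theorems are RH-FREE literature; nothing here is worded as progress toward RH. WHAT THIS IS NOT: not the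
window statement (K-v), not a criterion, not a route, no RH-relation of `K_θ` (a printed open question);
nothing here bears on the truth of RH.

Second companion ("de-factification") file of `SuzukiSingleOperatorKernel.lean` (statements untouched),
after `SuzukiSingleOperatorKernelProofs.lean`, for M. Suzuki, *Integral operators arising from the Riemann
zeta function*, Adv. Stud. Pure Math. **84** (2020) 399–411 = arXiv:1907.07302 [Suzuki2020IntegralOperators],
Thm. 1.2 (K-ii): «`K_θ(x) ≪ exp(x/2)` as `x → +∞`» — the one clause of (K-ii) left inside the named fact
`Suzuki2020_thm12` by the first Proofs file (which has continuity, the Fourier formula, and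
`|K_θ(x)| ≤ D_b e^{bx}` for every `b > ½`, `abs_limKernel_le`).

PROVED HERE (RH-free), for every `θ > 1`:

* §1 `norm_limTheta_le_of_mem_Ioc` — **uniform symbol decay down to the line `Im z = ½`**: there is
  `C` with `‖Θ_θ(u + ib)‖ ≤ C (1 + |u|)^{−(θ+1)/2}` for ALL `b ∈ (½, 1]` and all real `u`. The printed
  sentence «moving the path of integration … noting the growth of `ψ(s)` and the non-vanishing of `ζ(s)`
  for `Re(s) ≥ 1`» is made quantitative: `Re ξ′/ξ(σ + it) ≥ (½ − ε) log|t| − C_ε` uniformly for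
  `1 < σ ≤ 3/2`, `|t| ≥ 4`, from the explicit formula `ξ′/ξ = 1/s + 1/(s−1) − ½log π + ½ψ(s/2) − Σ Λ(n)n^{−s}`
  (tree `logDeriv_riemannXi_eq_of_one_lt_re`), Stirling from below for `Re ψ` (tree
  `log_norm_sub_three_le_re_digamma`) and the UNIFORM `o(log t)` bound for `ζ′/ζ` on the closed strip
  `1 ≤ σ ≤ 2` (tree `ZetaLogDerivVK.norm_logDeriv_zeta_le_of_mem_strip`, Phragmén–Lindelöf transfer of the
  Vinogradov–Korobov-strength line bound — non-vanishing on `Re s = 1` alone gives only `|Θ_θ| ≤ 1`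
  there, not integrability); near `u = 0` by compactness (`Θ_θ` is holomorphic on `Im z ≥ ½`).
* §2 **`Suzuki2020_thm12_growth`** — `∃ C, ∀ x, |K_θ(x)| ≤ C e^{x/2}`: `K_θ(x) = Re invFourierLine Θ_θ b x`
  for every `b ∈ (½, 1]` (line independence, tree `invFourierLine_limTheta_eq`), so
  `|K_θ(x)| ≤ (2π)⁻¹ e^{bx} C ∫(1+|u|)^{−(θ+1)/2} du` with a constant free of `b`; let `b ↓ ½`. Also in the
  typed shape of the (K-ii) clause of `Suzuki2020_thm12` (`∃ C x₀, ∀ x ≥ x₀, …`,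
  `Suzuki2020_thm12_Kii_growth`).

NOT proved here (still inside the named fact `Suzuki2020_thm12`): (K-iv) (differentiability off `{log n}`,
local integrability of `K_θ′`), which needs a Literature-side proof of the series representation (1.12).

## References

* [Suzuki2020IntegralOperators] M. Suzuki, ASPM 84 (2020) 399–411 = arXiv:1907.07302, Thm. 1.2 (K-ii) and
  §3 (proof: «moving the path of integration»).
* [Titchmarsh1986] E. C. Titchmarsh, *The Theory of the Riemann Zeta-Function*, 2nd ed., Theorem 5.17
  (5.17.4) (`ζ′/ζ(1+it) = O(log t/log log t)`).
-/

noncomputable section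

open Complex MeasureTheory Filter Topology Set
open scoped Real

namespace Literature.NumberTheory.LFunctions

open Literature.Analysis.SpecialFunctions Literature.Analysis.SpecialFunctions.Complex

/-! ## §1 Uniform decay of `Θ_θ` on the lines `Im z = b`, `½ < b ≤ 1` -/

/-- `½ − i(u + ib) = (½ + b) − iu`. [folklore] -/
private theorem half_sub_I_mul_line_eq' (u b : ℝ) :
    (1 : ℂ) / 2 - I * ((u : ℂ) + (b : ℂ) * I) = (((1 / 2 + b : ℝ)) : ℂ) + ((-u : ℝ) : ℂ) * I := by
  push_cast
  linear_combination (-(b : ℂ)) * I_mul_I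

/-- `Re(½ − i(u + ib)) = ½ + b`. [folklore] -/
private theorem re_half_sub_I_mul_line' (u b : ℝ) :
    ((1 : ℂ) / 2 - I * ((u : ℂ) + (b : ℂ) * I)).re = 1 / 2 + b := by
  rw [half_sub_I_mul_line_eq']; simp

/-- `Im(½ − i(u + ib)) = −u`. [folklore] -/
private theorem im_half_sub_I_mul_line' (u b : ℝ) :
    ((1 : ℂ) / 2 - I * ((u : ℂ) + (b : ℂ) * I)).im = -u := by
  rw [half_sub_I_mul_line_eq']; simp

open LSeries in
open scoped LSeries.notation ArithmeticFunction.vonMangoldt in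
/-- **`Re ξ′/ξ` from below near the line `Re s = 1`** (RH-free): for `θ`-free `ε > 0` there is `A` with
`(½ − ε) log|t| − A ≤ Re ξ′/ξ(σ + it)` for all `1 < σ ≤ 3/2`, `|t| ≥ 4` — the explicit formula for `ξ′/ξ`,
`Re 1/s, Re 1/(s−1) ≥ 0`, `Re ψ(s/2) ≥ log|s/2| − 3`, and `|Σ Λ(n)n^{−s}| = |ζ′/ζ(s)| ≤ ε log|t| + C_ε`
uniformly on the strip (`ZetaLogDerivVK.norm_logDeriv_zeta_le_of_mem_strip`).
[cite: Suzuki2020IntegralOperators, §3, proof of Thm. 1.2 (K-ii)] -/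
theorem re_logDeriv_riemannXi_ge_near_one {ε : ℝ} (hε : 0 < ε) :
    ∃ A : ℝ, ∀ s : ℂ, 1 < s.re → s.re ≤ 3 / 2 → 4 ≤ |s.im| →
      (1 / 2 - ε) * Real.log |s.im| - A ≤ (logDeriv riemannXi s).re := by
  obtain ⟨C₁, hC₁0, hC₁⟩ := ZetaLogDerivVK.norm_logDeriv_zeta_le_of_mem_strip hε
  refine ⟨3 + C₁, fun s hs1 hs32 ht => ?_⟩
  have ht0 : 0 < |s.im| := by linarith
  rw [logDeriv_riemannXi_eq_of_one_lt_re hs1]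
  simp only [Complex.add_re, Complex.sub_re]
  have h1 : 0 ≤ (1 / s).re := by
    rw [one_div, Complex.inv_re]; exact div_nonneg (by linarith) (Complex.normSq_nonneg _)
  have h2 : 0 ≤ (1 / (s - 1)).re := by
    rw [one_div, Complex.inv_re]
    exact div_nonneg (by simp; linarith) (Complex.normSq_nonneg _)
  have h3 : (-(Real.log π : ℂ) / 2).re = -(Real.log π) / 2 := by
    have : (-(Real.log π : ℂ) / 2) = ((-(Real.log π) / 2 : ℝ) : ℂ) := by push_cast; ring
    rw [this, Complex.ofReal_re]
  have h4 : ((1 / 2 : ℂ) * digamma (s / 2)).re = (digamma (s / 2)).re / 2 := by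
    have : ((1 / 2 : ℂ) * digamma (s / 2)).re = 1 / 2 * (digamma (s / 2)).re := by
      rw [show (1 / 2 : ℂ) = ((1 / 2 : ℝ) : ℂ) by push_cast; ring, Complex.re_ofReal_mul]
    rw [this]; ring
  have h5 : Real.log ‖s / 2‖ - 3 ≤ (digamma (s / 2)).re :=
    log_norm_sub_three_le_re_digamma (by simp; linarith)
  -- `‖L ↗Λ s‖ = ‖ζ′/ζ(s)‖ ≤ ε log|t| + C₁`
  have h6 : (L ↗Λ s).re ≤ ε * Real.log |s.im| + C₁ := by
    refine (Complex.re_le_norm _).trans ?_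
    rw [ArithmeticFunction.LSeries_vonMangoldt_eq_deriv_riemannZeta_div hs1, neg_div, norm_neg]
    exact hC₁ s hs1.le (by linarith) ht
  -- `log ‖s/2‖ ≥ log|t| − log 2`
  have h7 : Real.log |s.im| - Real.log 2 ≤ Real.log ‖s / 2‖ := by
    rw [norm_div, Complex.norm_two, Real.log_div (by linarith [Complex.abs_im_le_norm s]) two_ne_zero]
    linarith [Real.log_le_log ht0 (Complex.abs_im_le_norm s)]
  have h8 := log_pi_lt_two
  have h9 : 0 < Real.log π := Real.log_pos (by linarith [Real.pi_gt_three])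
  have h10 := Real.log_two_lt_d9
  rw [h3, h4]
  nlinarith

/-- A bound for `Θ_θ` on the compact box `|Re z| ≤ 4`, `½ ≤ Im z ≤ 1` (`Θ_θ` is holomorphic, hence
continuous, on the closed half-plane `Im z ≥ ½`). [cite: Suzuki2020IntegralOperators, §1 eq. (1.9)] -/
theorem exists_bound_limTheta_box (θ : ℝ) :
    ∃ M : ℝ, 0 ≤ M ∧ ∀ z : ℂ, |z.re| ≤ 4 → 1 / 2 ≤ z.im → z.im ≤ 1 → ‖limTheta θ z‖ ≤ M := by
  set B : Set ℂ := (Icc (-4 : ℝ) 4) ×ℂ (Icc (1 / 2 : ℝ) 1) with hBdef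
  have hB : IsCompact B :=
    Metric.isCompact_of_isClosed_isBounded (isClosed_Icc.reProdIm isClosed_Icc)
      ((Metric.isBounded_Icc _ _).reProdIm (Metric.isBounded_Icc _ _))
  have hcont : ContinuousOn (limTheta θ) B :=
    (differentiableOn_limTheta θ).continuousOn.mono fun z hz => hz.2.1
  obtain ⟨M, hM⟩ := hB.exists_bound_of_continuousOn hcont
  refine ⟨max M 0, le_max_right _ _, fun z hre him1 him2 => (hM z ?_).trans (le_max_left _ _)⟩
  exact ⟨abs_le.1 hre, him1, him2⟩

/-- **Uniform symbol decay down to `Im z = ½`** (RH-free): for `θ > 1` there is `C > 0` with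
`‖Θ_θ(u + ib)‖ ≤ C (1 + |u|)^{−(θ+1)/2}` for all `b ∈ (½, 1]` and all real `u`. (The tree's
`norm_limTheta_line_le` gives `(1+|u|)^{−θ}` only for `b ≥ b₀ > ½`, with a constant blowing up as
`b₀ ↓ ½`; here the constant is uniform at the price of the exponent `(θ+1)/2 ∈ (1, θ)`.)
[cite: Suzuki2020IntegralOperators, §3, proof of Thm. 1.2 (K-ii)] -/
theorem norm_limTheta_le_of_mem_Ioc {θ : ℝ} (hθ : 1 < θ) :
    ∃ C : ℝ, 0 < C ∧ ∀ b : ℝ, 1 / 2 < b → b ≤ 1 → ∀ u : ℝ,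
      ‖limTheta θ ((u : ℂ) + (b : ℂ) * I)‖ ≤ C * (1 + |u|) ^ (-((θ + 1) / 2)) := by
  have hθ0 : 0 < θ := by linarith
  set ε : ℝ := (θ - 1) / (4 * θ) with hεdef
  have hε : 0 < ε := by rw [hεdef]; exact div_pos (by linarith) (by linarith)
  set p : ℝ := (θ + 1) / 2 with hpdef
  have hp0 : 0 < p := by rw [hpdef]; linarith
  -- `2θ(½ − ε) = p`
  have hθε : 2 * θ * (1 / 2 - ε) = p := by
    rw [hεdef, hpdef]; field_simp; ring
  obtain ⟨A, hA⟩ := re_logDeriv_riemannXi_ge_near_one hε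
  obtain ⟨M, hM0, hM⟩ := exists_bound_limTheta_box θ
  refine ⟨Real.exp (2 * θ * A) * 2 ^ p + M * 5 ^ p + 1, by positivity, fun b hb1 hb2 u => ?_⟩
  set s := (1 : ℂ) / 2 - I * ((u : ℂ) + (b : ℂ) * I) with hs
  have hsre : s.re = 1 / 2 + b := by rw [hs, re_half_sub_I_mul_line']
  have hsim : s.im = -u := by rw [hs, im_half_sub_I_mul_line']
  have hu0 : 0 < 1 + |u| := by positivity
  have hrpow_pos : 0 < (1 + |u|) ^ (-p) := Real.rpow_pos_of_pos hu0 _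
  rcases le_or_gt 4 |u| with hu | hu
  · -- `|u| ≥ 4`: the quantitative lower bound for `Re ξ′/ξ`
    have hlow := hA s (by rw [hsre]; linarith) (by rw [hsre]; linarith) (by rw [hsim, abs_neg]; exact hu)
    rw [hsim, abs_neg] at hlow
    have hupos : 0 < |u| := by linarith
    rw [norm_limTheta, ← hs]
    have step1 : -2 * θ * (logDeriv riemannXi s).re ≤ 2 * θ * A + (-p) * Real.log |u| := by
      have h1 := mul_le_mul_of_nonneg_left hlow (by linarith : 0 ≤ 2 * θ)
      have h2 : 2 * θ * ((1 / 2 - ε) * Real.log |u| - A) = p * Real.log |u| - 2 * θ * A := by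
        rw [← hθε]; ring
      linarith
    -- `|u|^{-p} ≤ 2^p (1+|u|)^{-p}` since `1 + |u| ≤ 2|u|`
    have step2 : |u| ^ (-p) ≤ 2 ^ p * (1 + |u|) ^ (-p) := by
      have h2u : 1 + |u| ≤ 2 * |u| := by linarith
      calc |u| ^ (-p) = (|u| ^ p)⁻¹ := Real.rpow_neg hupos.le p
        _ ≤ (((1 + |u|) / 2) ^ p)⁻¹ := by
            rw [inv_le_inv₀ (Real.rpow_pos_of_pos hupos _) (Real.rpow_pos_of_pos (by positivity) _)]
            exact Real.rpow_le_rpow (by positivity) (by linarith) hp0.le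
        _ = 2 ^ p * (1 + |u|) ^ (-p) := by
            rw [Real.div_rpow hu0.le (by norm_num), Real.rpow_neg hu0.le, inv_div]
            field_simp
    calc Real.exp (-2 * θ * (logDeriv riemannXi s).re)
        ≤ Real.exp (2 * θ * A + (-p) * Real.log |u|) := Real.exp_le_exp.2 step1
      _ = Real.exp (2 * θ * A) * |u| ^ (-p) := by
          rw [Real.exp_add, Real.rpow_def_of_pos hupos, mul_comm (Real.log _)]
      _ ≤ Real.exp (2 * θ * A) * (2 ^ p * (1 + |u|) ^ (-p)) :=
          mul_le_mul_of_nonneg_left step2 (Real.exp_pos _).le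
      _ = Real.exp (2 * θ * A) * 2 ^ p * (1 + |u|) ^ (-p) := by ring
      _ ≤ (Real.exp (2 * θ * A) * 2 ^ p + M * 5 ^ p + 1) * (1 + |u|) ^ (-p) := by
          have : 0 ≤ (M * 5 ^ p + 1) * (1 + |u|) ^ (-p) := by positivity
          nlinarith
  · -- `|u| < 4`: compactness
    have hbox := hM ((u : ℂ) + (b : ℂ) * I) (by simp; exact hu.le) (by simp; linarith) (by simp; exact hb2)
    -- `1 ≤ 5^p (1+|u|)^{-p}` since `1 + |u| ≤ 5`
    have step : 1 ≤ 5 ^ p * (1 + |u|) ^ (-p) := by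
      rw [Real.rpow_neg hu0.le, ← div_eq_mul_inv, le_div_iff₀ (Real.rpow_pos_of_pos hu0 _), one_mul]
      exact Real.rpow_le_rpow hu0.le (by linarith) hp0.le
    calc ‖limTheta θ ((u : ℂ) + (b : ℂ) * I)‖ ≤ M := hbox
      _ ≤ M * (5 ^ p * (1 + |u|) ^ (-p)) := le_mul_of_one_le_right hM0 step
      _ = M * 5 ^ p * (1 + |u|) ^ (-p) := by ring
      _ ≤ (Real.exp (2 * θ * A) * 2 ^ p + M * 5 ^ p + 1) * (1 + |u|) ^ (-p) := by
          have : 0 ≤ (Real.exp (2 * θ * A) * 2 ^ p + 1) * (1 + |u|) ^ (-p) := by positivity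
          nlinarith

/-! ## §2 The sharp growth `|K_θ(x)| ≤ C e^{x/2}` -/

/-- The majorant `(1 + |u|)^{−p}` is integrable on `ℝ` for `p > 1`. [folklore] -/
private theorem integrable_one_add_abs_rpow_neg' {p : ℝ} (hp : 1 < p) :
    Integrable fun u : ℝ => (1 + |u|) ^ (-p) := by
  have h := integrable_one_add_norm (E := ℝ) (μ := volume) (r := p) (by simpa using hp)
  simpa [Real.norm_eq_abs] using h

/-- **Uniform growth of the line transforms down to `b = ½`** (RH-free): for `θ > 1` there is `D ≥ 0`
with `‖invFourierLine Θ_θ b x‖ ≤ D e^{bx}` for all `b ∈ (½, 1]` and all real `x`.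
[cite: Suzuki2020IntegralOperators, §3, proof of Thm. 1.2 (K-ii)] -/
theorem norm_invFourierLine_limTheta_le_of_mem_Ioc {θ : ℝ} (hθ : 1 < θ) :
    ∃ D : ℝ, 0 ≤ D ∧ ∀ b : ℝ, 1 / 2 < b → b ≤ 1 → ∀ x : ℝ,
      ‖invFourierLine (limTheta θ) b x‖ ≤ D * Real.exp (b * x) := by
  obtain ⟨C, hC0, hC⟩ := norm_limTheta_le_of_mem_Ioc hθ
  have hp : 1 < (θ + 1) / 2 := by linarith
  set Mp : ℝ := ∫ u : ℝ, (1 + |u|) ^ (-((θ + 1) / 2)) with hMp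
  have hMp0 : 0 ≤ Mp := integral_nonneg fun u => by positivity
  refine ⟨1 / (2 * Real.pi) * (C * Mp), by positivity, fun b hb1 hb2 x => ?_⟩
  have hint : ∫ u : ℝ, ‖limTheta θ ((u : ℂ) + (b : ℂ) * I)‖ ≤ C * Mp := by
    rw [hMp, ← integral_const_mul]
    exact integral_mono_of_nonneg (Eventually.of_forall fun u => norm_nonneg _)
      ((integrable_one_add_abs_rpow_neg' hp).const_mul C) (Eventually.of_forall fun u => hC b hb1 hb2 u)
  calc ‖invFourierLine (limTheta θ) b x‖
      ≤ 1 / (2 * Real.pi) * Real.exp (b * x) * ∫ u : ℝ, ‖limTheta θ ((u : ℂ) + (b : ℂ) * I)‖ :=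
        norm_invFourierLine_le _ _ _
    _ ≤ 1 / (2 * Real.pi) * Real.exp (b * x) * (C * Mp) := by gcongr
    _ = 1 / (2 * Real.pi) * (C * Mp) * Real.exp (b * x) := by ring

/-- **[Su20] Thm. 1.2 (K-ii), the sharp growth clause, PROVED** (RH-free): for `θ > 1` there is `C`
with `|K_θ(x)| ≤ C e^{x/2}` for ALL real `x` (printed: «`K_θ(x) ≪ exp(x/2)` as `x → +∞`»). Proof:
`K_θ(x) = Re invFourierLine Θ_θ b x` for every `b ∈ (½, 1]` with `‖·‖ ≤ D e^{bx}`, `D` free of `b`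
(`norm_invFourierLine_limTheta_le_of_mem_Ioc`); let `b ↓ ½`.
[cite: Suzuki2020IntegralOperators, Thm. 1.2 (K-ii)] -/
theorem Suzuki2020_thm12_growth {θ : ℝ} (hθ : 1 < θ) :
    ∃ C : ℝ, ∀ x : ℝ, |limKernel θ x| ≤ C * Real.exp (x / 2) := by
  obtain ⟨D, hD0, hD⟩ := norm_invFourierLine_limTheta_le_of_mem_Ioc hθ
  refine ⟨D, fun x => ?_⟩
  have hb : ∀ b : ℝ, 1 / 2 < b → b ≤ 1 → |limKernel θ x| ≤ D * Real.exp (b * x) := by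
    intro b hb1 hb2
    calc |limKernel θ x| = |(invFourierLine (limTheta θ) 1 x).re| := rfl
      _ ≤ ‖invFourierLine (limTheta θ) 1 x‖ := Complex.abs_re_le_norm _
      _ = ‖invFourierLine (limTheta θ) b x‖ := by
          rw [invFourierLine_limTheta_eq hθ (by norm_num) hb1]
      _ ≤ D * Real.exp (b * x) := hD b hb1 hb2 x
  -- let `b → ½⁺`
  have hlim : Tendsto (fun b : ℝ => D * Real.exp (b * x)) (𝓝[>] (1 / 2)) (𝓝 (D * Real.exp (1 / 2 * x))) :=
    ((by fun_prop : Continuous fun b : ℝ => D * Real.exp (b * x)).tendsto (1 / 2)).mono_left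
      nhdsWithin_le_nhds
  have hev : ∀ᶠ b : ℝ in 𝓝[>] (1 / 2), |limKernel θ x| ≤ D * Real.exp (b * x) := by
    filter_upwards [Ioc_mem_nhdsGT (show (1 / 2 : ℝ) < 1 by norm_num)] with b hbI
    exact hb b hbI.1 hbI.2
  have h := ge_of_tendsto hlim hev
  rwa [show (1 / 2 : ℝ) * x = x / 2 by ring] at h

/-- **[Su20] Thm. 1.2 (K-ii), growth clause in the typed shape of `Suzuki2020_thm12`** (RH-free): for
`θ > 1`, `∃ C x₀, ∀ x ≥ x₀, |K_θ(x)| ≤ C e^{x/2}` (here with any `x₀`; partial discharge next to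
`Suzuki2020_thm12_Kiii`, `Suzuki2020_thm12_continuous`, `Suzuki2020_thm12_fourier`, `Suzuki2020_thm12_Kv`).
[cite: Suzuki2020IntegralOperators, Thm. 1.2 (K-ii)] -/
theorem Suzuki2020_thm12_Kii_growth {θ : ℝ} (hθ : 1 < θ) :
    ∃ C x₀ : ℝ, ∀ x : ℝ, x₀ ≤ x → |limKernel θ x| ≤ C * Real.exp (x / 2) := by
  obtain ⟨C, hC⟩ := Suzuki2020_thm12_growth hθ
  exact ⟨C, 0, fun x _ => hC x⟩

/-- **[Su20] Thm. 1.2 (K-ii) in full, PROVED** (RH-free): for `θ > 1`, `K_θ` is continuous, `≪ e^{x/2}`,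
and the Fourier formula `∫ K_θ(x)e^{izx} dx = Θ_θ(z)` holds (with integrability) for `Im z > ½`.
[cite: Suzuki2020IntegralOperators, Thm. 1.2 (K-ii)] -/
theorem Suzuki2020_thm12_Kii {θ : ℝ} (hθ : 1 < θ) :
    Continuous (limKernel θ) ∧
    (∃ C x₀ : ℝ, ∀ x : ℝ, x₀ ≤ x → |limKernel θ x| ≤ C * Real.exp (x / 2)) ∧
    (∀ z : ℂ, 1 / 2 < z.im →
      Integrable (fun x : ℝ => (limKernel θ x : ℂ) * Complex.exp (I * z * x)) ∧
      ∫ x : ℝ, (limKernel θ x : ℂ) * Complex.exp (I * z * x) = limTheta θ z) :=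
  ⟨Suzuki2020_thm12_continuous hθ, Suzuki2020_thm12_Kii_growth hθ,
    fun _ hz => Suzuki2020_thm12_fourier hθ hz⟩

end Literature.NumberTheory.LFunctions

end
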